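import Literature.MathematicalPhysics.QuantumFieldTheory.Balaban1983to89.B16MergeHorizon

/-!
# `Balaban1983to89.B16CubeCurrency` — [Balaban1989LargeFieldII] pp. 384–386: the control sums of (1.80) in CUBE
currency (`s_n = #S^{n−j}(Z)`, the number of `MR_n`-cubes) — the cube-count profile of the `S`-iterates, the
majorant (1.81) with UNCHANGED constants, and the uptake into the creation-scale base case (1.82), the new-region
bracket of (1.85) and the inductive hypothesis of an old component, all in the currency of
`Step.Budget.controlsAm_merge_index`'s binder `hpiece` (cell seam `DIVERGENCE.md` D-f2.22, `STEP.md` §7.13 (4)(a),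
`GAPS.md` G-b02g11-1 located remainder (a); unit b2b-balaban-b02, gen 12 — NEW leaf module, imports `…B16MergeHorizon`
and modifies nothing)

CITATION HEADER (lean-in-tree rule 2026-08-18).  Source under audit: T. Bałaban, *Large field renormalization. II.
Localization, exponentiation, and bounds for the 𝐑 operation*, Commun. Math. Phys. **122**, 355–392 (1989)
[Balaban1989LargeFieldII] (cell paper B16; held `paper:balaban1989-cmp122-large-field-ii`, journal page = PDF page
+ 354; the passages below were read on the x2 renders `b2b-balaban-ref1/pages/1989-cmp122-large-field-II/…-p030-x2.png`
(p. 384), `…-p031-x2.png` (p. 385), `…-p032-x2.png` (p. 386)).  Flow inputs: T. Bałaban, *Convergent renormalization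
expansions for lattice gauge theories*, Commun. Math. Phys. **119**, 243–285 (1988) [Balaban1988Convergent] (= [III],
cell paper B14), (2.5) p. 255, (2.7) p. 255, (2.9) p. 256 — used ONLY through the typed displays `B14.IsRj`,
`B14.FlowIneq27` of module `…B14`, exactly as in `…B16SProfile` Part 8.  The papers are manuscripts UNDER ADJUDICATION
by the audit cell `pub-balaban`: NOTHING printed in them is asserted here; every `theorem` below is finite
combinatorics on `ℤᵈ` and real arithmetic, proved without `sorry` and without new axioms, over the EXISTING
definitions `B13ScaleTransfer.{Pt, closureIdx, FaceConnected}`, `TreeLength.treeLen`, `B16SProfile.{Sop, Siter, Qprod,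
ratio, DropCtl}`, `B16StoppingRule.StopAt`, `Step.Budget.{Consts, Consts.cost, RStepLe, ControlsAm}`,
`Step.InInterval`, `B14.{IsRj, FlowIneq27}`; the `[cite: …]` tags LOCATE the printed shape a kernel theorem reads and
import nothing printed as a hypothesis.

THE PRINTED TEXT (locators; the geometry of `S` is quoted in full in the header of `…B16SProfile`).  B16 p. 384
[PDF 30], (1.80): *"κ_j(Z) ≥ Σ_{n=j+1}^{j+K} O(1)M^dR_n^{d+1}d′_n(S^{n−j}(Z))"*, and the display after it:
*"d′_n(S^{n−j}(Z)) ≤ (63)^d(MR_n)^{−d}|Z^{(n−j)}| ≤ (63)^d 3·2^{d−1} d′_n(Z^{(n−j)}) if the linear size on the right-hand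
side is different from 0, or d′_n(S^{n−j}(Z)) ≤ (64)^d if it is equal to 0"* — the MIDDLE TERM `(63)^d(MR_n)^{−d}|Z^{(n−j)}|`
is a CUBE COUNT (`|·|` the volume, `(MR_n)^{−d}|Z^{(n−j)}|` = the number of `MR_n`-cubes of the cover); p. 385 [PDF 31],
(1.81): *"Σ_{n=j+1}^{j+K} O(1)M^dR_n^{d+1}d′_n(S^{n−j}(Z)) ≤ … ≤ O(1)(64)^dM^dL^{d+1}R_j^{d+2}(d′_j(Z) + 1)"*; (1.82):
*"κ_1(Z) ≥ ¼γ_0(14)^{−d}A_1²p_0²(g_1)(d′_1(Z) + 1) − O(1)M^dR_1^{d+1}d′_1(Z)"* and *"Thus, by the estimate (1.81), the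
statement holds for j = 1, i.e., the inequality (1.80) holds for j = 1, if ¼γ_0(14)^{−d}A_1²p_0²(g_1) ≥
O(1)2(64)^dM^dL^{d+1}R_1^{d+2}. This condition is satisfied for p_0 large, and g_1 sufficiently small."*; p. 386
[PDF 32], (1.85), the bracket of a new large field region `Z_{j+1}^{(i)}`: *"Σ_i(γ₀A₁²p₀²(g_{j+1})(d′_{j+1}(Z_{j+1}^{(i)}) +
1) + 2p₀(g_{j+1}))"* (quoted in full in `…Step` Part F, `Budget.merge`).

WHY THIS MODULE (the cell seam, NOT a print divergence).  Print runs the induction (1.80)–(1.89) in ONE currency, the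
tree length `d′`.  The cell's typed skeleton `Step.Budget` is linear in an abstract size `s : ℝ` and has TWO
inhabitants of the size slot: the b02 lineage's (1.81) majorant chain (`B16SProfile.majorant_181_of_B14`,
`B16StoppingRule.majorant_181_and_stop_of_B14`; `s_n = d′_n(S^{n−j}Z) = treeLen` — print's currency), consumed by
`StepInhabited` Part M/N (`controls_of_182`, `controlsAm_of_182`), and the amortised merger in the ℤᵈ index model
(`StepInhabitedMergeIndex.controlsAm_merge_index`, f2 Part O.2, over this lineage's overhang calculus
`B16Overhang`/`B16OverhangN`), whose pieces' hypothesis `hpiece : ControlsAm b θ j (a x + 1) (κ x) (fun n =>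
#Siter (ratio L σ) (n − (j+1)) (B x))` and conclusion are in CUBE currency (`s_n = #S^{n−j}`), because set differences
and one-cube layers are counted there.  The two currencies agree up to dimensional constants on face-connected sets
(`TreeLength.treeLen_le_card_sub_one`, `TreeLength.card_le_treeLen`), but the induction `j → j+1` must run in ONE
currency.  This module supplies the CHEAP DIRECTION: the majorant and its three consumers restated with the cube
profile, so that every producer of `hpiece` — the creation-scale base case, the bracket of a new region, the inductive
hypothesis of an old component carried to the merger — is a kernel theorem BY NAME in O.2's currency.  FINDING: the
restatement costs NO constant — `B16SProfile.profile_h1`/`profile_h2` already pass through the cube count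
(`card_Siter_le`, `card_le_treeLen`) and discard the `−1` of `treeLen_le_card_sub_one`, so the cube profile obeys the
SAME bounds `10·126^d·(½)^{n−j}·d′_j(Z)` / `5·126^d` (the seam's recorded estimate «constants ×2^d·4 inside h1/h2»,
`DIVERGENCE.md` D-f2.22, was pessimistic); the only new located inequality is `4·2^d ≤ A′` for the creation-scale cost of
a new region (`cost_{j+1}(#Y) ≤ A′·Q·(d′_{j+1}(Y) + 1)`), satisfied by the lineage's `A′ = 10·126^d`.  The brackets and
the subtracted creation cost of (1.79)/(1.82)/(1.85) stay in print's currency `d′` (MIXED FORM: cube profile, tree-length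
size parameter `s₀ = d′_j(Z)`), so no located smallness row changes.

WHAT IS PROVED (unconditionally, every dimension `d`; `d_b = b.d` the dimension parameter of the cost constants).
* Part 1 (cube profile): `#S^{i}(Z) ≤ 126^d·(4·d′(Z^{(i)}) + 1)` (`card_Siter_le_cover`, `L ≥ 3`, `DropCtl`, `i ≤ m`);
  hence `#S^{i}(Z) ≤ 10·126^d·(½)^i·d′_j(Z)` while `d′(Z^{(i)}) ≥ 1`, `1 ≤ i`, `L ≥ 4` (`card_profile_h1`) and
  `#S^{i}(Z) ≤ 5·126^d` once `d′(Z^{(i)}) < 1` (`card_profile_h2`).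
* Part 2 ((1.81) in cube currency): `card_majorant_181_of_flow` = `Step.Budget.majorant_181_of_rStepLe` with `h1`, `h2`
  supplied by Part 1 — `Σ_{n=j+1}^{n₀+r} cost_n(#S^{n−j}(Z)) ≤ C·M^{d_b}·(L^{d_b+1}R_j^{d_b+1})·(10·126^d·d′_j(Z) + 5·126^d·r)`;
  `exponents_log` ((2.5) ⇒ the CANONICAL exponents `σ_n = log_L R_n`, with the minimality clause); END TO END from the
  flow of [III] with the hypotheses of `B16SProfile.majorant_181_of_B14` verbatim: `card_majorant_181_and_stop_of_B14` —
  for the canonical exponents a threshold scale `n₀ ∈ [j, K]` with (b), (c) the printed thresholds, (d) the tree-length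
  majorant AND (d′) the cube majorant for every tail, and (e) the stopping property at `n₀ − j + N` (`N ≥ 1` the memory,
  size parameter `≥ 64`, cleanliness after the creation scale) — ONE `n₀` and ONE flow serving every consumer.
* Part 3 (uptake, in the binder shapes of `StepInhabited` Parts M/N and of O.2): `cost_card_le_third_181` (the
  creation-scale cost of a region in cube currency is within the majorant currency `A′·Q·(d′ + 1)` for `A′ ≥ 4·2^d`);
  `controlsAm_of_182_card` ((1.80)-amortised at the creation scale `j` from (1.82), cube profile: Part N's
  `controlsAm_of_182` with `hmid` DISCHARGED by Part 2 — binders left: the thresholds of `n₀`, the horizon facts, the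
  stopping rule `hstop`, (1.82) `h182` and the located condition `hcond : 2(1+θ)·A′Q ≤ a`, `A′ ≥ 10·126^d`);
  `controlsAm_bracket_card` (a NEW REGION `Y` born at scale `j+1`: `(1+θ)·(cost_{j+1}(#Y) + Σ_{n=j+2}^{j+1+K_Y}
  cost_n(#S^{n−j−1}(Y))) ≤ a·(d′_{j+1}(Y) + 1)` — LITERALLY the `hpiece` shape `ControlsAm b θ j (K_Y + 1) (a·(d′_{j+1}(Y)+1))
  (fun n => #S^{n−(j+1)}(Y))` of `controlsAm_merge_index`, from Part 2, `Step.Budget.sum_le_third_181` and `bracket_am`);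
  `controlsAm_shift_body` / `controlsAm_shift_body_ratio` (an OLD COMPONENT `X`: its amortised statement at scale `j`
  along the flow `q` IS the `hpiece` statement at the scale-`(j+1)` merger for the body `S(X) = Sop (q 0) X` along the
  shifted flow — `B16MergeHorizon.Siter_add`; for `ratio` flows the shifted flow is the `ratio` flow of the shifted
  exponents, `B16MergeHorizon.ratio_shift_fun`).
* Part 4 (index shifts in ABSOLUTE exponents, the form consumers name): `Siter_shift_index`; `controlsAm_shift_body_from`
  (the re-indexing for an amortised statement based at any `j₀ ≥ j` — also after case 1, `Step.Budget.case1_am`);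
  `controlsAm_shift_body_abs` (profile of `X` from scale `j` along `ratio L (fun i => σ (j + i))` ↦ profile of the body
  `Sop (ratio L (fun i => σ (j + i)) 0) X` from scale `j+1` along `ratio L (fun i => σ (j + 1 + i))` — with the canonical
  `σ = log_L ∘ R` the base case, case 1, the merger's `hpiece` and the merger's conclusion all name the same flows, so the
  induction (1.80)–(1.89) chains BY NAME in the index model, cube currency).
WHAT IS *NOT* ASSERTED: the stopping rule itself beyond `B16StoppingRule` (the binder `hstop : j + K ≤ n₀ + R_j` stays,
discharged there for the least stopping index by `hstop_of_threshold`); the overhang budget or anything of Part O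
(consumed, not re-proved); that the amortised bookkeeping is Bałaban's ((1.80)-amortised is the CELL's construct,
`StepInhabited` Part N, `DIVERGENCE.md` D-f2.21); the identification of the index model with print's domains
(`DIVERGENCE.md` D-b02g9.1); anything about fields, densities, `κ_j` as defined by (1.79)/(1.83)/(1.85), or the located
smallness conditions beyond carrying them as the binders `h182`, `hcond`; summit progress.  Value = kernel-checked
bookkeeping closing a typed seam between two cell currencies, NOT summit progress.
-/

namespace Literature.MathematicalPhysics.QuantumFieldTheory.Balaban1983to89.B16CubeCurrency

open Literature.MathematicalPhysics.QuantumFieldTheory.Balaban1983to89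
open Literature.MathematicalPhysics.QuantumFieldTheory.Balaban1983to89.B13ScaleTransfer
open Literature.MathematicalPhysics.QuantumFieldTheory.Balaban1983to89.TreeLength
open Literature.MathematicalPhysics.QuantumFieldTheory.Balaban1983to89.B16SProfile
open Literature.MathematicalPhysics.QuantumFieldTheory.Balaban1983to89.B16StoppingRule

noncomputable section

variable {d : ℕ}

/-! ## Part 1. The cube-count profile of the iterates `S^{i}(Z)` -/

/-- THE MIDDLE TERM of the display after (1.80), with the repaired lower (2.30): `#S^{i}(Z) ≤ 63^d·#Z^{(i)} ≤
126^d·(4·d′(Z^{(i)}) + 1)` (`L ≥ 3`, `DropCtl σ m`, `i ≤ m`, `Z` non-empty face-connected) — `B16SProfile.card_Siter_le`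
and `TreeLength.card_le_treeLen`. [cite: Balaban1989LargeFieldII, p.384 (display after (1.80))] -/
theorem card_Siter_le_cover {L : ℕ} {σ : ℕ → ℕ} {m i : ℕ} (hL : 3 ≤ L) (h : DropCtl σ m)
    {Z : Finset (Pt d)} (hZ : Z.Nonempty) (hZc : FaceConnected Z) (hi : i ≤ m) :
    ((Siter (ratio L σ) i Z).card : ℝ) ≤ 126 ^ d * (4 * treeLen (closureIdx (Qprod (ratio L σ) i) Z) + 1) := by
  have hL0 : 0 < L := by omega
  have h2 : ((Siter (ratio L σ) i Z).card : ℝ) ≤ 63 ^ d * ((closureIdx (Qprod (ratio L σ) i) Z).card : ℝ) := by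
    exact_mod_cast card_Siter_le hL h Z hi
  have h3 := card_le_treeLen (closureIdx_nonempty hZ)
    (faceConnected_closureIdx (Qprod_pos (ratio_pos hL0 σ) i) hZc)
  have h63 : (0 : ℝ) ≤ 63 ^ d := by positivity
  have h126 : (63 : ℝ) ^ d * 2 ^ d = 126 ^ d := by rw [← mul_pow]; norm_num
  calc ((Siter (ratio L σ) i Z).card : ℝ) ≤ 63 ^ d * ((closureIdx (Qprod (ratio L σ) i) Z).card : ℝ) := h2
    _ ≤ 63 ^ d * (2 ^ d * (4 * treeLen (closureIdx (Qprod (ratio L σ) i) Z) + 1)) :=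
        mul_le_mul_of_nonneg_left h3 h63
    _ = 126 ^ d * (4 * treeLen (closureIdx (Qprod (ratio L σ) i) Z) + 1) := by rw [← mul_assoc, h126]

/-- BINDER `h1` OF `Step.Budget.majorant_181` IN CUBE CURRENCY: while `d′(Z^{(i)}) ≥ 1` (`1 ≤ i ≤ m`, `L ≥ 4`),
`#S^{i}(Z) ≤ 10·126^d·(½)^i·d′_j(Z)` — the SAME constant as `B16SProfile.profile_h1`. [cite: Balaban1989LargeFieldII, (1.81) p.385] -/
theorem card_profile_h1 {L : ℕ} {σ : ℕ → ℕ} {m i : ℕ} (hL : 4 ≤ L) (h : DropCtl σ m)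
    {Z : Finset (Pt d)} (hZ : Z.Nonempty) (hZc : FaceConnected Z) (hi1 : 1 ≤ i) (hi : i ≤ m)
    (ht : 1 ≤ treeLen (closureIdx (Qprod (ratio L σ) i) Z)) :
    ((Siter (ratio L σ) i Z).card : ℝ) ≤ 10 * 126 ^ d * (1 / 2 : ℝ) ^ i * treeLen Z := by
  set t := treeLen (closureIdx (Qprod (ratio L σ) i) Z) with ht_def
  have hs := card_Siter_le_cover (show 3 ≤ L by omega) h hZ hZc hi
  have hhalf := half_pow_mul_treeLen_ge hL h hZ hZc hi1 hi
  rw [← ht_def] at hs hhalf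
  have hp : (0 : ℝ) ≤ 126 ^ d := by positivity
  have hs' : ((Siter (ratio L σ) i Z).card : ℝ) ≤ 5 * 126 ^ d * t := by
    nlinarith [mul_le_mul_of_nonneg_left ht hp]
  calc ((Siter (ratio L σ) i Z).card : ℝ) ≤ 5 * 126 ^ d * t := hs'
    _ = 10 * 126 ^ d * ((1 / 2 : ℝ) * t) := by ring
    _ ≤ 10 * 126 ^ d * ((1 / 2 : ℝ) ^ i * treeLen Z) := mul_le_mul_of_nonneg_left hhalf (by positivity)
    _ = 10 * 126 ^ d * (1 / 2 : ℝ) ^ i * treeLen Z := by ring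

/-- BINDER `h2` OF `Step.Budget.majorant_181` IN CUBE CURRENCY: once `d′(Z^{(i)}) < 1` (`i ≤ m`, `L ≥ 3`),
`#S^{i}(Z) ≤ 5·126^d` — the SAME constant as `B16SProfile.profile_h2` (*"S^{n₀+1−j}(Z) is contained in a cube of the
size 64MR_{n₀+1}"*). [cite: Balaban1989LargeFieldII, (1.81) p.385] -/
theorem card_profile_h2 {L : ℕ} {σ : ℕ → ℕ} {m i : ℕ} (hL : 3 ≤ L) (h : DropCtl σ m)
    {Z : Finset (Pt d)} (hZ : Z.Nonempty) (hZc : FaceConnected Z) (hi : i ≤ m)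
    (ht : treeLen (closureIdx (Qprod (ratio L σ) i) Z) < 1) :
    ((Siter (ratio L σ) i Z).card : ℝ) ≤ 5 * 126 ^ d := by
  set t := treeLen (closureIdx (Qprod (ratio L σ) i) Z) with ht_def
  have hs := card_Siter_le_cover hL h hZ hZc hi
  rw [← ht_def] at hs
  have hp : (0 : ℝ) ≤ 126 ^ d := by positivity
  have h4 : 4 * t + 1 ≤ 5 := by linarith
  nlinarith [mul_le_mul_of_nonneg_left h4 hp]

/-! ## Part 2. (1.81) in cube currency: second to third expression along the flow, and end to end from [III] -/

/-- (1.81), SECOND TO THIRD EXPRESSION, CUBE CURRENCY (= `Step.Budget.majorant_181_of_rStepLe` with `h1 :=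
card_profile_h1`, `h2 := card_profile_h2`): for sizes `R_n = L^{σ_n}` on `[0, K]` obeying (2.9)'s first member
(`RStepLe`) and the two-sided drop control, `L ≥ 4`, a non-empty face-connected `Z`, and the threshold index `n₀`
(`d′(Z^{(n−j)}) ≥ 1` on `(j, n₀]`, `< 1` on `(n₀, n₀+r]`, `n₀ + r ≤ K`):
`Σ_{n=j+1}^{n₀+r} cost_n(#S^{n−j}(Z)) ≤ C·M^{d_b}·(L^{d_b+1}R_j^{d_b+1})·(10·126^d·d′_j(Z) + 5·126^d·r)` — the same right side as
`B16SProfile.majorant_181_of_flow`. [cite: Balaban1989LargeFieldII, (1.81) p.385] -/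
theorem card_majorant_181_of_flow (b : Step.Budget.Consts) (L : ℕ) (hL : 4 ≤ L) (K j n₀ r : ℕ)
    (hj : j ≤ n₀) (hK : n₀ + r ≤ K) (σ : ℕ → ℕ) (hRpow : ∀ n, n ≤ K → b.R n = (L : ℝ) ^ σ n)
    (h29a : Step.Budget.RStepLe b.R L K)
    (hdrop : ∀ m n, m < n → n ≤ K → 2 * σ m ≤ 2 * σ n + max (n - m) 2)
    (hC : 0 ≤ b.C) (hM : 0 ≤ b.M) (Z : Finset (Pt d)) (hZ : Z.Nonempty) (hZc : FaceConnected Z)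
    (hn₀ : ∀ n ∈ Finset.Ioc j n₀,
      1 ≤ treeLen (closureIdx (Qprod (ratio L (fun i => σ (j + i))) (n - j)) Z))
    (hn₀' : ∀ n ∈ Finset.Ioc n₀ (n₀ + r),
      treeLen (closureIdx (Qprod (ratio L (fun i => σ (j + i))) (n - j)) Z) < 1) :
    ∑ n ∈ Finset.Ioc j (n₀ + r),
        b.cost n ((Siter (ratio L (fun i => σ (j + i))) (n - j) Z).card : ℝ) ≤
      b.C * b.M ^ b.d * ((L : ℝ) ^ (b.d + 1) * b.R j ^ (b.d + 1)) *
        (10 * 126 ^ d * treeLen Z + 5 * 126 ^ d * r) := by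
  have hD : DropCtl (fun i => σ (j + i)) (K - j) := B16SProfile.dropCtl_shift hdrop
  refine Step.Budget.majorant_181_of_rStepLe b L K j n₀ r hj hK (10 * 126 ^ d) (5 * 126 ^ d) (treeLen Z)
    (fun n => ((Siter (ratio L (fun i => σ (j + i))) (n - j) Z).card : ℝ)) hC hM (by positivity)
    (treeLen_nonneg Z) (by positivity) (by positivity) h29a ?_ ?_ ?_
  · intro n hn
    rw [hRpow n hn]
    positivity
  · intro n hn
    have hn' := Finset.mem_Ioc.mp hn
    exact card_profile_h1 hL hD hZ hZc (by omega) (by omega) (hn₀ n hn)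
  · intro n hn
    have hn' := Finset.mem_Ioc.mp hn
    exact card_profile_h2 (show 3 ≤ L by omega) hD hZ hZc (by omega) (hn₀' n hn)

/-- (2.5) on the horizon, CANONICAL EXPONENTS: `R_n = L^{σ_n}` with `σ_n := log_L R_n` (`L ≥ 2`), the lower bound
`(log g_n⁻²)^p ≤ R_n`, and the minimality of `σ_n` — the `hσ` of `B16SProfile.dropCtl_of_27b` WITHOUT a choice of
exponents, so that every consumer names THE SAME flow `ratio L (fun i => log_L R_{j+i})`. [cite: Balaban1988Convergent, (2.5) p.255] -/
theorem exponents_log {L p K : ℕ} (hL : 1 < L) {g : ℕ → ℝ} (R : ℕ → ℕ)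
    (hR : ∀ n, n ≤ K → B14.IsRj L p (g n) (R n)) :
    ∀ n, n ≤ K → R n = L ^ Nat.log L (R n) ∧ (Real.log ((g n) ^ 2)⁻¹) ^ p ≤ (R n : ℝ) ∧
      ∀ s' : ℕ, (Real.log ((g n) ^ 2)⁻¹) ^ p ≤ ((L ^ s' : ℕ) : ℝ) → Nat.log L (R n) ≤ s' := by
  intro n hn
  obtain ⟨s, hs, hb, hmin⟩ := hR n hn
  have e : Nat.log L (R n) = s := by rw [hs, Nat.log_pow hL]
  rw [e]
  exact ⟨hs, hb, hmin⟩

/-- END TO END FROM THE FLOW OF [Balaban1988Convergent] §2, BOTH CURRENCIES, ONE FLOW — the hypotheses of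
`B16SProfile.majorant_181_of_B14` / `B16StoppingRule.majorant_181_and_stop_of_B14` verbatim (sizes from (2.5) on the
horizon `K`, (2.9)'s first member, (2.7), the located smallness `(1 + g_n²β′(n−m))^{β₀} ≤ L^{⌊max(n−m,2)/2⌋}`, `L ≥ 4`, a
non-empty face-connected `Z` at a scale `j ≤ K`), for THE CANONICAL exponents `σ_n = log_L R_n`: (a) `R_n = L^{σ_n}` on
the horizon; a threshold scale `n₀ ∈ [j, K]` with (b) `d′(Z^{(n−j)}) ≥ 1` on `(j, n₀]` and (c) `< 1` on `(n₀, K]`; (d) the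
second-to-third bound of (1.81) for every tail `r ≤ K − n₀` in TREE-LENGTH currency and (d′) in CUBE currency (same right
side); (e) for every size parameter `Nsz ≥ 64`, memory `N ≥ 1` and cleanliness predicate holding after the creation
scale, the stopping property (inclusive (ii)) at the relative index `n₀ − j + N` whenever `n₀ + N ≤ K`
(`B16StoppingRule.stopAt_threshold`; hence `j + K_stop ≤ n₀ + N` for the least stopping index,
`B16StoppingRule.hstop_of_threshold`).  The stopping RULE is not re-proved here; nothing printed is asserted. [cite: Balaban1989LargeFieldII, p.384-385 ((1.80), (1.81), K ≤ n₀ − j + R_j)] -/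
theorem card_majorant_181_and_stop_of_B14 (b : Step.Budget.Consts) {L p K : ℕ} (hL : 4 ≤ L) {g : ℕ → ℝ}
    {γ β' β₀ : ℝ} (hI : Step.InInterval γ K g) (hγ1 : γ ≤ 1) (R : ℕ → ℕ)
    (hR : ∀ n, n ≤ K → B14.IsRj L p (g n) (R n)) (hbR : ∀ n, n ≤ K → b.R n = (R n : ℝ))
    (h29a : ∀ m n, m < n → n ≤ K → (R n : ℝ) ≤ L * R m) (h27 : B14.FlowIneq27 g β' β₀ p K)
    (hΘ : ∀ m n, m < n → n ≤ K →
      (1 + (g n) ^ 2 * β' * ((n : ℝ) - m)) ^ β₀ ≤ (L : ℝ) ^ (max (n - m) 2 / 2))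
    (hC : 0 ≤ b.C) (hM : 0 ≤ b.M) (Z : Finset (Pt d)) (hZ : Z.Nonempty) (hZc : FaceConnected Z)
    (j : ℕ) (hjK : j ≤ K) :
    ∃ n₀ : ℕ, (∀ n, n ≤ K → R n = L ^ Nat.log L (R n)) ∧ j ≤ n₀ ∧ n₀ ≤ K ∧
      (∀ n ∈ Finset.Ioc j n₀,
        1 ≤ treeLen (closureIdx (Qprod (ratio L (fun i => Nat.log L (R (j + i)))) (n - j)) Z)) ∧
      (∀ n ∈ Finset.Ioc n₀ K,
        treeLen (closureIdx (Qprod (ratio L (fun i => Nat.log L (R (j + i)))) (n - j)) Z) < 1) ∧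
      (∀ r, n₀ + r ≤ K →
        ∑ n ∈ Finset.Ioc j (n₀ + r),
            b.cost n (treeLen (Siter (ratio L (fun i => Nat.log L (R (j + i)))) (n - j) Z)) ≤
          b.C * b.M ^ b.d * ((L : ℝ) ^ (b.d + 1) * b.R j ^ (b.d + 1)) *
            (10 * 126 ^ d * treeLen Z + 5 * 126 ^ d * r)) ∧
      (∀ r, n₀ + r ≤ K →
        ∑ n ∈ Finset.Ioc j (n₀ + r),
            b.cost n ((Siter (ratio L (fun i => Nat.log L (R (j + i)))) (n - j) Z).card : ℝ) ≤
          b.C * b.M ^ b.d * ((L : ℝ) ^ (b.d + 1) * b.R j ^ (b.d + 1)) *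
            (10 * 126 ^ d * treeLen Z + 5 * 126 ^ d * r)) ∧
      ∀ (Nsz N : ℕ) (Clean : ℕ → Prop), 64 ≤ Nsz → 1 ≤ N → (∀ l, 1 ≤ l → l ≤ K - j → Clean l) →
        n₀ + N ≤ K →
          StopAt Nsz N Clean (fun i => Siter (ratio L (fun i => Nat.log L (R (j + i)))) i Z) (n₀ - j + N) := by
  have hL0 : 0 < L := by omega
  set σ : ℕ → ℕ := fun n => Nat.log L (R n) with hσ_def
  have hσ := exponents_log (show 1 < L by omega) R hR
  obtain ⟨i₀, hi₀, hA, hB⟩ := exists_threshold hL0 (fun i => σ (j + i)) (K - j) hZ hZc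
  have hRpow : ∀ n, n ≤ K → b.R n = (L : ℝ) ^ σ n := by
    intro n hn
    rw [hbR n hn, (hσ n hn).1]
    push_cast
    rfl
  have h29 : Step.Budget.RStepLe b.R L K := by
    intro m n hmn hnK
    rw [hbR n hnK, hbR m (le_trans hmn.le hnK)]
    exact h29a m n hmn hnK
  have hdrop := dropCtl_of_27b (by omega) hI hγ1 R σ hσ h27 hΘ
  have hD : DropCtl (fun i => σ (j + i)) (K - j) := B16SProfile.dropCtl_shift hdrop
  refine ⟨j + i₀, fun n hn => (hσ n hn).1, by omega, by omega, ?_, ?_, ?_, ?_, ?_⟩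
  · intro n hn
    have hn' := Finset.mem_Ioc.mp hn
    exact hA (n - j) (by omega) (by omega)
  · intro n hn
    have hn' := Finset.mem_Ioc.mp hn
    exact hB (n - j) (by omega) (by omega)
  · intro r hr
    refine majorant_181_of_flow b L hL K j (j + i₀) r (by omega) hr σ hRpow h29 hdrop hC hM Z hZ hZc ?_ ?_
    · intro n hn
      have hn' := Finset.mem_Ioc.mp hn
      exact hA (n - j) (by omega) (by omega)
    · intro n hn
      have hn' := Finset.mem_Ioc.mp hn
      exact hB (n - j) (by omega) (by omega)
  · intro r hr
    refine card_majorant_181_of_flow b L hL K j (j + i₀) r (by omega) hr σ hRpow h29 hdrop hC hM Z hZ hZc ?_ ?_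
    · intro n hn
      have hn' := Finset.mem_Ioc.mp hn
      exact hA (n - j) (by omega) (by omega)
    · intro n hn
      have hn' := Finset.mem_Ioc.mp hn
      exact hB (n - j) (by omega) (by omega)
  · intro Nsz N Clean hNsz hN hclean hNK
    have := stopAt_threshold hNsz hN (by omega) hD hZ hZc i₀ (fun i h1 h2 => hB i h1 h2) Clean hclean
      (show i₀ + N ≤ K - j by omega)
    rwa [show j + i₀ - j + N = i₀ + N by omega]

/-! ## Part 3. Uptake: the creation-scale base case (1.82), the bracket of a new region (1.85), and the inductive
hypothesis of an old component — all in the cube currency of `Step.Budget.controlsAm_merge_index`'s `hpiece` -/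

/-- `4·2^d ≤ 10·126^d`: the lineage's majorant constant `A′ = 10·126^d` dominates the currency constant of the
creation-scale cost. [folklore] -/
theorem four_mul_two_pow_le : (4 : ℝ) * 2 ^ d ≤ 10 * 126 ^ d := by
  have h : (2 : ℝ) ^ d ≤ 126 ^ d := pow_le_pow_left₀ (by norm_num) (by norm_num) d
  have h0 : (0 : ℝ) ≤ 2 ^ d := by positivity
  nlinarith

/-- THE CREATION-SCALE COST OF A REGION IN CUBE CURRENCY is within the majorant currency of (1.81)/(1.82): for a
non-empty face-connected `Y`, `cost_j(#Y) ≤ A′·(C·M^{d_b}·L^{d_b+1}·R_j^{d_b+2})·(d′_j(Y) + 1)` as soon as `A′ ≥ 4·2^d`,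
`L ≥ 1`, `R_j ≥ 1` — from the repaired lower (2.30) `#Y ≤ 2^d(4·d′(Y) + 1) ≤ 4·2^d·(d′(Y) + 1)`
(`TreeLength.card_le_treeLen`); the `hcost` of `Step.Budget.bracket_am` for a new region whose future costs are
counted in cubes.  Cf. `Step.Budget.cost_le_third_181` (the same in tree-length currency, `A′ ≥ 1`). [folklore] -/
theorem cost_card_le_third_181 (b : Step.Budget.Consts) (L A' : ℝ) (j Rj : ℕ) (hC : 0 ≤ b.C) (hM : 0 ≤ b.M)
    (hL : 1 ≤ L) (hA' : 4 * 2 ^ d ≤ A') (hRj : b.R j = Rj) (h1Rj : 1 ≤ Rj)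
    {Y : Finset (Pt d)} (hY : Y.Nonempty) (hYc : FaceConnected Y) :
    b.cost j (Y.card : ℝ) ≤ A' * (b.C * b.M ^ b.d * L ^ (b.d + 1) * b.R j ^ (b.d + 2)) * (treeLen Y + 1) := by
  have ht0 := treeLen_nonneg Y
  have hcard : (Y.card : ℝ) ≤ 4 * 2 ^ d * (treeLen Y + 1) := by
    have h := card_le_treeLen hY hYc
    have h2d : (0 : ℝ) ≤ 2 ^ d := by positivity
    nlinarith
  unfold Step.Budget.Consts.cost
  rw [hRj]
  have h1Rj' : (1 : ℝ) ≤ Rj := by exact_mod_cast h1Rj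
  have hA'0 : 0 ≤ A' := le_trans (by positivity) hA'
  have hP : 0 ≤ b.C * b.M ^ b.d * (Rj : ℝ) ^ (b.d + 1) := by positivity
  have hX : (4 : ℝ) * 2 ^ d ≤ A' * L ^ (b.d + 1) * Rj := by
    have hL' : (1 : ℝ) ≤ L ^ (b.d + 1) := one_le_pow₀ hL
    have h1 : A' ≤ A' * L ^ (b.d + 1) := by nlinarith
    have h2 : A' * L ^ (b.d + 1) ≤ A' * L ^ (b.d + 1) * Rj := by
      have : 0 ≤ A' * L ^ (b.d + 1) := by positivity
      nlinarith
    linarith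
  calc b.C * b.M ^ b.d * (Rj : ℝ) ^ (b.d + 1) * (Y.card : ℝ)
      ≤ b.C * b.M ^ b.d * (Rj : ℝ) ^ (b.d + 1) * (4 * 2 ^ d * (treeLen Y + 1)) :=
        mul_le_mul_of_nonneg_left hcard hP
    _ ≤ b.C * b.M ^ b.d * (Rj : ℝ) ^ (b.d + 1) * ((A' * L ^ (b.d + 1) * Rj) * (treeLen Y + 1)) := by
        apply mul_le_mul_of_nonneg_left _ hP
        exact mul_le_mul_of_nonneg_right hX (by linarith)
    _ = A' * (b.C * b.M ^ b.d * L ^ (b.d + 1) * (Rj : ℝ) ^ (b.d + 2)) * (treeLen Y + 1) := by ring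

/-- (1.80)-AMORTISED AT THE CREATION SCALE `j`, CUBE CURRENCY, END TO END MODULO ITS NAMED INPUTS
(`Step.Budget.controlsAm_of_182` with the profile `s_n = #S^{n−j}(Z)`, the size parameter `s₀ = d′_j(Z)` and `hmid`
DISCHARGED by `card_majorant_181_of_flow`): along a flow `R_n = L^{σ_n}` on `[0, K_f]` with (2.9a) and the drop control,
`L ≥ 4`, for a non-empty face-connected `Z` created at scale `j` with threshold scale `n₀` (`hA`, `hB`), a control
horizon `K_Z` inside the flow horizon, `R_j = Rj ≥ 1` a natural number, THE STOPPING RULE `hstop : j + K_Z ≤ n₀ + R_j`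
(`B16StoppingRule.hstop_of_threshold` for the least stopping index), (1.82) `h182 : a·(d′_j(Z) + 1) − cost_j(d′_j(Z)) ≤ κ`
and the located condition of p. 385 strengthened by the reserve, `hcond : 2(1+θ)·A′·(C·M^{d_b}L^{d_b+1}R_j^{d_b+2}) ≤ a`
with `A′ ≥ 10·126^d`: `κ` controls the `K_Z` steps with reserve `θ` IN CUBES — `ControlsAm b θ j K_Z κ (fun n =>
#S^{n−j}(Z))`.  NOT a printed statement (the amortised form is the cell's); (1.82) and the condition enter as binders,
verbatim in print's currency. [cite: Balaban1989LargeFieldII, (1.80)–(1.82) p.384–385] -/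
theorem controlsAm_of_182_card (b : Step.Budget.Consts) (θ a A' κ : ℝ) {L : ℕ} (hL : 4 ≤ L) (σ : ℕ → ℕ)
    (Kf j n₀ KZ Rj : ℕ) (hRpow : ∀ n, n ≤ Kf → b.R n = (L : ℝ) ^ σ n) (h29a : Step.Budget.RStepLe b.R L Kf)
    (hdrop : ∀ m n, m < n → n ≤ Kf → 2 * σ m ≤ 2 * σ n + max (n - m) 2)
    (hθ : 0 ≤ θ) (hC : 0 ≤ b.C) (hM : 0 ≤ b.M) (hA' : 10 * 126 ^ d ≤ A')
    {Z : Finset (Pt d)} (hZ : Z.Nonempty) (hZc : FaceConnected Z)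
    (hj : j ≤ n₀) (hn₀ : n₀ ≤ Kf) (hKZ : j + KZ ≤ Kf) (hRj : b.R j = Rj) (h1Rj : 1 ≤ Rj)
    (hstop : j + KZ ≤ n₀ + Rj)
    (hA : ∀ n ∈ Finset.Ioc j n₀, 1 ≤ treeLen (closureIdx (Qprod (ratio L (fun i => σ (j + i))) (n - j)) Z))
    (hB : ∀ n ∈ Finset.Ioc n₀ Kf, treeLen (closureIdx (Qprod (ratio L (fun i => σ (j + i))) (n - j)) Z) < 1)
    (h182 : a * (treeLen Z + 1) - b.cost j (treeLen Z) ≤ κ)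
    (hcond : 2 * (1 + θ) * (A' * (b.C * b.M ^ b.d * (L : ℝ) ^ (b.d + 1) * b.R j ^ (b.d + 2))) ≤ a) :
    Step.Budget.ControlsAm b θ j KZ κ (fun n => ((Siter (ratio L (fun i => σ (j + i))) (n - j) Z).card : ℝ)) := by
  have hL1 : (1 : ℝ) ≤ (L : ℝ) := by exact_mod_cast (show 1 ≤ L by omega)
  have hp : (0 : ℝ) < 126 ^ d := by positivity
  have h1p : (1 : ℝ) ≤ 126 ^ d := one_le_pow₀ (by norm_num)
  have hA'1 : (1 : ℝ) ≤ A' := by linarith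
  have hBA : (5 : ℝ) * 126 ^ d ≤ A' := by linarith
  have hR0 : ∀ n, n ≤ Kf → 0 ≤ b.R n := by
    intro n hn
    rw [hRpow n hn]
    positivity
  have hmid : ∀ r : ℕ, n₀ + r ≤ Kf →
      ∑ n ∈ Finset.Ioc j (n₀ + r), b.cost n ((Siter (ratio L (fun i => σ (j + i))) (n - j) Z).card : ℝ) ≤
        b.C * b.M ^ b.d * ((L : ℝ) ^ (b.d + 1) * b.R j ^ (b.d + 1)) * (10 * 126 ^ d * treeLen Z + 5 * 126 ^ d * r) :=
    fun r hr => card_majorant_181_of_flow b L hL Kf j n₀ r hj hr σ hRpow h29a hdrop hC hM Z hZ hZc hA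
      (fun n hn => hB n (Finset.Ioc_subset_Ioc_right hr hn))
  exact Step.Budget.controlsAm_of_182 b θ L (10 * 126 ^ d) (5 * 126 ^ d) A' (treeLen Z) κ a Kf j n₀ KZ Rj
    (fun n => ((Siter (ratio L (fun i => σ (j + i))) (n - j) Z).card : ℝ)) hθ hC hM hL1 (by positivity) hA' hBA
    hA'1 (treeLen_nonneg Z) hn₀ hKZ hRj h1Rj hstop hR0 (fun n => Nat.cast_nonneg _) hmid h182 hcond

/-- THE BRACKET OF A NEW LARGE FIELD REGION, CUBE CURRENCY, IN THE SHAPE OF `hpiece` — a region `Y` (non-empty,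
face-connected) born at scale `j+1` along a flow `R_n = L^{σ_n}` on `[0, K_f]` ((2.9a), drop control, `L ≥ 4`), with
threshold scale `n₀ ≥ j+1`, own control horizon `K_Y` (`j + 1 + K_Y ≤ K_f`), `R_{j+1} = Rj ≥ 1`, THE STOPPING RULE
`hstop : j + 1 + K_Y ≤ n₀ + R_{j+1}`, and the located condition of p. 385 at scale `j+1` strengthened by the reserve,
`hcond : 2(1+θ)·A′·(C·M^{d_b}L^{d_b+1}R_{j+1}^{d_b+2}) ≤ a` (`A′ ≥ 10·126^d`): the bracket `a·(d′_{j+1}(Y) + 1)` of (1.85)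
(`a = γ₀A₁²p₀²(g_{j+1})`) pays `(1+θ)`-times the creation-scale cost `cost_{j+1}(#Y)` AND the future costs
`Σ_{n=j+2}^{j+1+K_Y} cost_n(#S^{n−j−1}(Y))` — LITERALLY `ControlsAm b θ j (K_Y + 1) (a·(d′_{j+1}(Y) + 1)) (fun n =>
#S^{n−(j+1)}(Y))`, the hypothesis `hpiece` of `Step.Budget.controlsAm_merge_index` for the piece `Y` with `a x = K_Y`.
`card_majorant_181_of_flow` ∘ `Step.Budget.sum_le_third_181` ∘ `cost_card_le_third_181` ∘ `Step.Budget.bracket_am`.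
NOT a printed statement. [cite: Balaban1989LargeFieldII, (1.85) p.386] -/
theorem controlsAm_bracket_card (b : Step.Budget.Consts) (θ a A' : ℝ) {L : ℕ} (hL : 4 ≤ L) (σ : ℕ → ℕ)
    (Kf j n₀ KY Rj : ℕ) (hRpow : ∀ n, n ≤ Kf → b.R n = (L : ℝ) ^ σ n) (h29a : Step.Budget.RStepLe b.R L Kf)
    (hdrop : ∀ m n, m < n → n ≤ Kf → 2 * σ m ≤ 2 * σ n + max (n - m) 2)
    (hθ : 0 ≤ θ) (hC : 0 ≤ b.C) (hM : 0 ≤ b.M) (hA' : 10 * 126 ^ d ≤ A')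
    {Y : Finset (Pt d)} (hY : Y.Nonempty) (hYc : FaceConnected Y)
    (hj : j + 1 ≤ n₀) (hn₀ : n₀ ≤ Kf) (hKY : j + 1 + KY ≤ Kf) (hRj : b.R (j + 1) = Rj) (h1Rj : 1 ≤ Rj)
    (hstop : j + 1 + KY ≤ n₀ + Rj)
    (hA : ∀ n ∈ Finset.Ioc (j + 1) n₀,
      1 ≤ treeLen (closureIdx (Qprod (ratio L (fun i => σ (j + 1 + i))) (n - (j + 1))) Y))
    (hB : ∀ n ∈ Finset.Ioc n₀ Kf,
      treeLen (closureIdx (Qprod (ratio L (fun i => σ (j + 1 + i))) (n - (j + 1))) Y) < 1)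
    (hcond : 2 * (1 + θ) * (A' * (b.C * b.M ^ b.d * (L : ℝ) ^ (b.d + 1) * b.R (j + 1) ^ (b.d + 2))) ≤ a) :
    Step.Budget.ControlsAm b θ j (KY + 1) (a * (treeLen Y + 1))
      (fun n => ((Siter (ratio L (fun i => σ (j + 1 + i))) (n - (j + 1)) Y).card : ℝ)) := by
  have hL1 : (1 : ℝ) ≤ (L : ℝ) := by exact_mod_cast (show 1 ≤ L by omega)
  have hp : (0 : ℝ) < 126 ^ d := by positivity
  have hBA : (5 : ℝ) * 126 ^ d ≤ A' := by linarith
  have h4A' : (4 : ℝ) * 2 ^ d ≤ A' := le_trans four_mul_two_pow_le hA'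
  have hR0 : ∀ n, n ≤ Kf → 0 ≤ b.R n := by
    intro n hn
    rw [hRpow n hn]
    positivity
  set s : ℕ → ℝ := fun n => ((Siter (ratio L (fun i => σ (j + 1 + i))) (n - (j + 1)) Y).card : ℝ) with hs_def
  have hmid : ∀ r : ℕ, n₀ + r ≤ Kf → ∑ n ∈ Finset.Ioc (j + 1) (n₀ + r), b.cost n (s n) ≤
      b.C * b.M ^ b.d * ((L : ℝ) ^ (b.d + 1) * b.R (j + 1) ^ (b.d + 1)) *
        (10 * 126 ^ d * treeLen Y + 5 * 126 ^ d * r) :=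
    fun r hr => card_majorant_181_of_flow b L hL Kf (j + 1) n₀ r hj hr σ hRpow h29a hdrop hC hM Y hY hYc hA
      (fun n hn => hB n (Finset.Ioc_subset_Ioc_right hr hn))
  have hsum := Step.Budget.sum_le_third_181 b L (10 * 126 ^ d) (5 * 126 ^ d) A' (treeLen Y) Kf (j + 1) n₀ KY Rj s
    hC hM (by positivity) (by positivity) hA' hBA (treeLen_nonneg Y) hn₀ hKY hRj h1Rj hstop hR0
    (fun n => Nat.cast_nonneg _) hmid
  have hcost := cost_card_le_third_181 b (L : ℝ) A' (j + 1) Rj hC hM hL1 h4A' hRj h1Rj hY hYc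
  have hbr := Step.Budget.bracket_am a (A' * (b.C * b.M ^ b.d * (L : ℝ) ^ (b.d + 1) * b.R (j + 1) ^ (b.d + 2)))
    (b.cost (j + 1) (Y.card : ℝ)) (∑ n ∈ Finset.Ioc (j + 1) (j + 1 + KY), b.cost n (s n)) (treeLen Y) θ
    (treeLen_nonneg Y) hθ hsum hcost hcond
  unfold Step.Budget.ControlsAm
  rw [Step.Budget.sum_Ioc_succ_split _ j (KY + 1) (by omega), show j + (KY + 1) = j + 1 + KY by omega]
  have e0 : s (j + 1) = (Y.card : ℝ) := by
    simp only [hs_def, Nat.sub_self, Siter_zero]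
  rw [e0]
  exact hbr

/-- AN OLD COMPONENT CARRIED TO THE MERGER: the amortised statement of `X` at scale `j` along a ratio sequence `q`
(profile `#S^{n−j}(X) = #Siter q (n − j) X`) IS the statement for the body `S(X) = Sop (q 0) X` at scale `j+1` along
the shifted sequence `q′_l = q_{1+l}` (profile `#Siter q′ (n − (j+1)) (S(X))`) — the same sum term by term, since
`S^{1+t}(X) = S′^{t}(S(X))` (`B16MergeHorizon.Siter_add`) and the range `(j, j+K]` only meets `n ≥ j+1`.  This is how
the inductive hypothesis (1.80) for `Z_j^{(n)}` enters `hpiece` for the piece `B x = S(Z_j^{(n)})` (horizon `a x + 1 = K`).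
[folklore] -/
theorem controlsAm_shift_body (b : Step.Budget.Consts) (θ κ : ℝ) (q : ℕ → ℕ) (j K : ℕ) (X : Finset (Pt d))
    (h : Step.Budget.ControlsAm b θ j K κ (fun n => ((Siter q (n - j) X).card : ℝ))) :
    Step.Budget.ControlsAm b θ j K κ
      (fun n => ((Siter (fun l => q (1 + l)) (n - (j + 1)) (Sop (q 0) X)).card : ℝ)) := by
  unfold Step.Budget.ControlsAm at h ⊢
  have e : ∀ n ∈ Finset.Ioc j (j + K),
      b.cost n ((Siter (fun l => q (1 + l)) (n - (j + 1)) (Sop (q 0) X)).card : ℝ) =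
        b.cost n ((Siter q (n - j) X).card : ℝ) := by
    intro n hn
    have hn' := Finset.mem_Ioc.mp hn
    have h1 : n - j = 1 + (n - (j + 1)) := by omega
    rw [h1, B16MergeHorizon.Siter_add q 1 X (n - (j + 1))]
    rfl
  rw [Finset.sum_congr rfl e]
  exact h

/-- `controlsAm_shift_body` for `ratio` flows: along `R_n = L^{τ_n}` (exponents `τ` relative to scale `j`) the shifted
ratio sequence is the ratio sequence of the shifted exponents (`B16MergeHorizon.ratio_shift_fun`), so the statement of
`X` at scale `j` along `ratio L τ` is the `hpiece` statement of `Step.Budget.controlsAm_merge_index` for the body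
`Sop (ratio L τ 0) X` along `ratio L (fun i => τ (1 + i))`. [folklore] -/
theorem controlsAm_shift_body_ratio (b : Step.Budget.Consts) (θ κ : ℝ) (L : ℕ) (τ : ℕ → ℕ) (j K : ℕ)
    (X : Finset (Pt d)) (h : Step.Budget.ControlsAm b θ j K κ (fun n => ((Siter (ratio L τ) (n - j) X).card : ℝ))) :
    Step.Budget.ControlsAm b θ j K κ
      (fun n => ((Siter (ratio L (fun i => τ (1 + i))) (n - (j + 1)) (Sop (ratio L τ 0) X)).card : ℝ)) := by
  have h' := controlsAm_shift_body b θ κ (ratio L τ) j K X h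
  rwa [B16MergeHorizon.ratio_shift_fun L τ 1] at h'

/-! ## Part 4. Index shifts in absolute exponents: the induction `j → j+1` chains by name

With THE canonical absolute exponents `σ_n = log_L R_n` (`exponents_log`) every statement of the induction names the flow
of its own creation scale, `ratio L (fun i => σ (j + i))` with the profile `fun n => #Siter … (n − j) X`.  The two moves of
the step `j → j+1` that change the creation scale of a domain — an old component entering a merger as the piece `S(X)`, and
case 1 ((1.83), `Step.Budget.case1_am`: `Z = S(Z₀)`, no merger) — are the SAME re-indexing of the profile, valid for an
amortised statement based at any scale `j₀ ≥ j` (the range `(j₀, j₀+K]` only meets `n ≥ j+1`). -/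

/-- One `S`-step split off the iterate, as an identity of profiles: for `n ≥ j+1`,
`S^{n−j}(X) = S′^{n−(j+1)}(S(X))` along the shifted ratio sequence (`B16MergeHorizon.Siter_add`). [folklore] -/
theorem Siter_shift_index (q : ℕ → ℕ) {j n : ℕ} (hn : j + 1 ≤ n) (X : Finset (Pt d)) :
    Siter q (n - j) X = Siter (fun l => q (1 + l)) (n - (j + 1)) (Sop (q 0) X) := by
  have h1 : n - j = 1 + (n - (j + 1)) := by omega
  rw [h1, B16MergeHorizon.Siter_add q 1 X (n - (j + 1))]
  rfl

/-- `controlsAm_shift_body` for an amortised statement based at ANY scale `j₀ ≥ j` (so also AFTER case 1, `Step.Budget.case1_am`,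
whose output is based at `j+1` with the creation-scale-`j` profile): the profile of `X` from scale `j` along `q` may be
replaced by the profile of the body `Sop (q 0) X` from scale `j+1` along the shifted sequence. [folklore] -/
theorem controlsAm_shift_body_from (b : Step.Budget.Consts) (θ κ : ℝ) (q : ℕ → ℕ) (j j₀ K : ℕ) (hj : j ≤ j₀)
    (X : Finset (Pt d)) (h : Step.Budget.ControlsAm b θ j₀ K κ (fun n => ((Siter q (n - j) X).card : ℝ))) :
    Step.Budget.ControlsAm b θ j₀ K κ
      (fun n => ((Siter (fun l => q (1 + l)) (n - (j + 1)) (Sop (q 0) X)).card : ℝ)) := by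
  unfold Step.Budget.ControlsAm at h ⊢
  have e : ∀ n ∈ Finset.Ioc j₀ (j₀ + K),
      b.cost n ((Siter (fun l => q (1 + l)) (n - (j + 1)) (Sop (q 0) X)).card : ℝ) =
        b.cost n ((Siter q (n - j) X).card : ℝ) := by
    intro n hn
    have hn' := Finset.mem_Ioc.mp hn
    rw [Siter_shift_index q (show j + 1 ≤ n by omega) X]
  rw [Finset.sum_congr rfl e]
  exact h

/-- THE RE-INDEXING IN ABSOLUTE EXPONENTS (the form every consumer names): an amortised statement based at `j₀ ≥ j` with the
creation-scale-`j` profile of `X` along `ratio L (fun i => σ (j + i))` IS the statement with the creation-scale-`(j+1)`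
profile of the body `S(X) = Sop (ratio L (fun i => σ (j + i)) 0) X` along `ratio L (fun i => σ (j + 1 + i))` — LITERALLY the
`hpiece` shape of `Step.Budget.controlsAm_merge_index` (`j₀ = j`, O.2's `σ := fun i => σ (j + 1 + i)`, `B x := S(X)`,
`a x + 1 := K`) and the inductive-hypothesis shape at scale `j+1` after case 1 (`j₀ = j + 1`).  `controlsAm_shift_body_from` ∘
`B16MergeHorizon.ratio_shift_fun`, plus `j + 1 + i = j + (1 + i)`. [folklore] -/
theorem controlsAm_shift_body_abs (b : Step.Budget.Consts) (θ κ : ℝ) (L : ℕ) (σ : ℕ → ℕ) (j j₀ K : ℕ) (hj : j ≤ j₀)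
    (X : Finset (Pt d))
    (h : Step.Budget.ControlsAm b θ j₀ K κ (fun n => ((Siter (ratio L (fun i => σ (j + i))) (n - j) X).card : ℝ))) :
    Step.Budget.ControlsAm b θ j₀ K κ
      (fun n => ((Siter (ratio L (fun i => σ (j + 1 + i))) (n - (j + 1))
        (Sop (ratio L (fun i => σ (j + i)) 0) X)).card : ℝ)) := by
  have h' := controlsAm_shift_body_from b θ κ (ratio L (fun i => σ (j + i))) j j₀ K hj X h
  rw [B16MergeHorizon.ratio_shift_fun L (fun i => σ (j + i)) 1] at h'
  have e : (fun i => σ (j + 1 + i)) = (fun i => σ (j + (1 + i))) := by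
    funext i
    rw [Nat.add_assoc]
  rw [e]
  exact h'

end

end Literature.MathematicalPhysics.QuantumFieldTheory.Balaban1983to89.B16CubeCurrency
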